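import Summits.AnomalousDissipation.AnomalousDissipation.Theorems.SawtoothPulseCascadeK1LocalisedCascadeShearStabilityCascade
import Summits.AnomalousDissipation.AnomalousDissipation.Theorems.SawtoothPulseCascadeK1LocalisedCascadeStripStepV

/-!
# K1loc, line `Spectral` / thin start — helper: THE ROUNDED AND THE EXACT INVISCID ITERATES STAY `L²`-CLOSE (n phases)

Helper file of the prover lane on the crux `K1LocalisedCascade` (stmt-AnomalousDissipation-19491), route
`SawtoothPulseCascade` (S-B ↔ S-D glue for the START of the ledger).  Iterates `…ShearStabilityCascade` over the `2n` half-steps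
from the common datum: the inviscid iterates `(a_j, b_j)` of the ROUNDED cascade (`CascadeParams`, `δ_j = δ₀/d^j`) and ANY pair of
sequences `(a⁰_j, b⁰_j)` obeying the EXACT-sawtooth recursion (`a⁰₀ = datum`, `b⁰_j(x) = a⁰_j(x − γ·tri(2πN_j x₁)/(2πN_j)·e₀)`,
`a⁰_{j+1}(x) = b⁰_j(x − γ·tri(2πN_j x₀)/(2πN_j)·e₁)`; no definition is introduced — the sequences are hypotheses, as for `(a, b)`)
satisfy, for every `M ≥ 1` with `Mδ_j < π/2`:
* `continuous_exactIterate` — `a⁰_n`, `b⁰_n` are continuous;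
* **`sqrt_integral_iterate_sub_exact_le`** —
  `‖a_n − a⁰_n‖_{L²} ≤ Σ_{j<n} (r_j(2π(1+γ)^{2j}) + r_j(2π(1+γ)^{2j+1}))`, `r_j(L) = √((Lγe^{−M²/2}/(2N_j))² + 4·(4Mδ_j/π))`
  (sup bound `1`, gradient bounds of `…IterateGradient`, Lipschitz bridge and half-step comparison of `…ShearStabilityCascade`),
  and the same for `‖b_n − b⁰_n‖_{L²}` with the extra H term.
With `…TrackedEnergyTransfer` this turns any certified class energy of the EXACT iterate `a⁰_3` into a start bound for the ledger
of the rounded cascade (`δ₀` small).  No definitions; no statement about the crux.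
[cite: ElgindiLissMattingly2025, §1 (slope ±1 branches)] [cite: BardosTitiWiedemann2012, Lemma 4] [problem: turb]
-/

-- `Summit.<Summit>.<Problem>`: single-conjunct summit, the duplicate namespace segment is deliberate.
set_option linter.dupNamespace false

noncomputable section

namespace Summit.AnomalousDissipation.AnomalousDissipation.Theorems.SawtoothPulseCascade.K1Start

open MeasureTheory Set Filter Topology UnitAddTorus Function Metric
open scoped Real
open Literature.Analysis.FunctionSpaces Literature.Analysis.FunctionSpaces.Torus
open Literature.Analysis.FluidPDE Literature.Analysis.FluidPDE.ShearStage
open Literature.Analysis.FluidPDE.SawtoothCascade Literature.Analysis.FluidPDE.SawtoothCascade.CascadeParams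
open Summit.AnomalousDissipation.AnomalousDissipation.Theorems.SawtoothPulseCascade.K1Window

section Cascade

variable (P : CascadeParams)

/-- **The exact-sawtooth iterates are continuous.** [folklore] -/
theorem continuous_exactIterate (a : ℕ → UnitAddTorus (Fin 2) → ℝ) (has : ∀ j, IsSmooth (a j)) (h0 : a 0 = datum)
    (a0 b0 : ℕ → UnitAddTorus (Fin 2) → ℝ) (h00 : a0 0 = datum)
    (hb0 : ∀ j, b0 j = fun x => a0 j (x - Pi.single 0 ((((periodic_exactProfile P j).lift (x 1) : ℝ) : UnitAddCircle))))
    (hab0 : ∀ j, a0 (j + 1) = fun x => b0 j (x - Pi.single 1 ((((periodic_exactProfile P j).lift (x 0) : ℝ) : UnitAddCircle))))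
    (n : ℕ) : Continuous (a0 n) ∧ Continuous (b0 n) := by
  have hshear : ∀ (p q : Fin 2) (j : ℕ), Continuous fun x : UnitAddTorus (Fin 2) =>
      x - Pi.single p ((((periodic_exactProfile P j).lift (x q) : ℝ) : UnitAddCircle)) := fun p q j =>
    continuous_id.sub ((continuous_single p).comp ((continuous_exactCircleMap P j).comp (continuous_apply q)))
  have ha : ∀ n, Continuous (a0 n) := by
    intro n
    induction n with
    | zero => rw [h00, ← h0]; exact (has 0).continuous
    | succ n ih =>
      rw [hab0 n]
      have hbn : Continuous (b0 n) := by rw [hb0 n]; exact ih.comp (hshear 0 1 n)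
      exact hbn.comp (hshear 1 0 n)
  exact ⟨ha n, by rw [hb0 n]; exact (ha n).comp (hshear 0 1 n)⟩

/-- **THE ROUNDED AND THE EXACT ITERATES STAY `L²`-CLOSE.**  With `r_j(L) := √((L·γe^{−M²/2}/(2N_j))² + 2²·(4Mδ_j/π))`:
`‖a_n − a⁰_n‖_{L²} ≤ Σ_{j<n} (r_j(2π(1+γ)^{2j}) + r_j(2π(1+γ)^{2j+1}))` and
`‖b_n − b⁰_n‖_{L²} ≤ ‖a_n − a⁰_n‖_{L²}-bound + r_n(2π(1+γ)^{2n})`.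
[cite: ElgindiLissMattingly2025, §1 (slope ±1 branches)] [cite: BardosTitiWiedemann2012, Lemma 4] -/
theorem sqrt_integral_iterate_sub_exact_le (hδ₀ : 0 < P.δ₀) (hd : 0 < P.d) (hN₀ : 1 ≤ P.N₀) (hρ : 1 ≤ P.ρN)
    (hγ : 0 ≤ P.γ) {M : ℝ} (hM : 1 ≤ M) (hMδ : ∀ j, M * P.δ j < π / 2)
    (a b : ℕ → UnitAddTorus (Fin 2) → ℝ) (has : ∀ j, IsSmooth (a j)) (h0 : a 0 = datum)
    (hb : ∀ j, b j = a j ∘ shearMap 0 1 (amp ⟨P.U j, P.U_periodic j, P.contDiff_U (P.δ_pos hδ₀ hd j)⟩ P.γ))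
    (hab : ∀ j, a (j + 1) = b j ∘ shearMap 1 0 (amp ⟨P.U j, P.U_periodic j, P.contDiff_U (P.δ_pos hδ₀ hd j)⟩ P.γ))
    (a0 b0 : ℕ → UnitAddTorus (Fin 2) → ℝ) (h00 : a0 0 = datum)
    (hb0 : ∀ j, b0 j = fun x => a0 j (x - Pi.single 0 ((((periodic_exactProfile P j).lift (x 1) : ℝ) : UnitAddCircle))))
    (hab0 : ∀ j, a0 (j + 1) = fun x => b0 j (x - Pi.single 1 ((((periodic_exactProfile P j).lift (x 0) : ℝ) : UnitAddCircle))))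
    (n : ℕ) :
    Real.sqrt (∫ x : UnitAddTorus (Fin 2), ‖((a n x : ℝ) : ℂ) - ((a0 n x : ℝ) : ℂ)‖ ^ 2) ≤
        ∑ j ∈ Finset.range n,
          (Real.sqrt ((2 * π * (1 + P.γ) ^ (2 * j) * (P.γ * (Real.exp (-(M ^ 2 / 2)) / (2 * P.N j)))) ^ 2 +
              (2 * 1) ^ 2 * (4 * M * P.δ j / π)) +
            Real.sqrt ((2 * π * (1 + P.γ) ^ (2 * j + 1) * (P.γ * (Real.exp (-(M ^ 2 / 2)) / (2 * P.N j)))) ^ 2 +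
              (2 * 1) ^ 2 * (4 * M * P.δ j / π))) ∧
      Real.sqrt (∫ x : UnitAddTorus (Fin 2), ‖((b n x : ℝ) : ℂ) - ((b0 n x : ℝ) : ℂ)‖ ^ 2) ≤
        (∑ j ∈ Finset.range n,
          (Real.sqrt ((2 * π * (1 + P.γ) ^ (2 * j) * (P.γ * (Real.exp (-(M ^ 2 / 2)) / (2 * P.N j)))) ^ 2 +
              (2 * 1) ^ 2 * (4 * M * P.δ j / π)) +
            Real.sqrt ((2 * π * (1 + P.γ) ^ (2 * j + 1) * (P.γ * (Real.exp (-(M ^ 2 / 2)) / (2 * P.N j)))) ^ 2 +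
              (2 * 1) ^ 2 * (4 * M * P.δ j / π)))) +
          Real.sqrt ((2 * π * (1 + P.γ) ^ (2 * n) * (P.γ * (Real.exp (-(M ^ 2 / 2)) / (2 * P.N n)))) ^ 2 +
            (2 * 1) ^ 2 * (4 * M * P.δ n / π)) := by
  -- the data of the smooth iterates
  have hG : ∀ l x, |partialDeriv l (a 0) x| ≤ 2 * π := fun l x => by rw [h0]; exact abs_partialDeriv_datum_le l x
  have hgrad := fun j => abs_partialDeriv_iterate_le P hγ hδ₀ hd a b has hb hab Real.two_pi_pos.le hG j
  have hsup := fun j => abs_iterate_le_one P hδ₀ hd a b h0 hb hab j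
  have hbs : ∀ j, IsSmooth (b j) := fun j => isSmooth_b P hδ₀ hd a b has hb j
  have hcont0 := fun j => continuous_exactIterate P a has h0 a0 b0 h00 hb0 hab0 j
  -- complexifications
  have hC : ∀ {u : UnitAddTorus (Fin 2) → ℝ}, Continuous u → Continuous fun x => ((u x : ℝ) : ℂ) := fun hu =>
    Complex.continuous_ofReal.comp hu
  have hB : ∀ {u : UnitAddTorus (Fin 2) → ℝ}, (∀ x, |u x| ≤ 1) → ∀ y, ‖((u y : ℝ) : ℂ)‖ ≤ 1 := fun hu y => by
    rw [Complex.norm_real, Real.norm_eq_abs]; exact hu y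
  have hLipC : ∀ {u : UnitAddTorus (Fin 2) → ℝ} (hu : IsSmooth u) (p : Fin 2) {D : ℝ} (hD : ∀ l x, |partialDeriv l u x| ≤ D),
      ∀ (y : UnitAddTorus (Fin 2)) (s : UnitAddCircle), ‖((u (y - Pi.single p s) : ℝ) : ℂ) - ((u y : ℝ) : ℂ)‖ ≤ D * ‖s‖ := by
    intro u hu p D hD y s
    rw [← Complex.ofReal_sub, Complex.norm_real]
    exact norm_sub_single_sub_le_of_partialDeriv hu p (fun x => by rw [Real.norm_eq_abs]; exact hD p x) y s
  -- the two half-step comparisons at phase `j`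
  have stepH : ∀ j, Real.sqrt (∫ x : UnitAddTorus (Fin 2), ‖((b j x : ℝ) : ℂ) - ((b0 j x : ℝ) : ℂ)‖ ^ 2) ≤
      Real.sqrt ((2 * π * (1 + P.γ) ^ (2 * j) * (P.γ * (Real.exp (-(M ^ 2 / 2)) / (2 * P.N j)))) ^ 2 +
        (2 * 1) ^ 2 * (4 * M * P.δ j / π)) +
        Real.sqrt (∫ x : UnitAddTorus (Fin 2), ‖((a j x : ℝ) : ℂ) - ((a0 j x : ℝ) : ℂ)‖ ^ 2) := by
    intro j
    have h := sqrt_integral_norm_sq_rounded_sub_exact_le P hδ₀ hd hN₀ hρ hγ hM (hMδ j) (p := (0 : Fin 2)) (q := 1)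
      (by decide) (hC (has j).continuous) (hC (hcont0 j).1) (hB (hsup j).1) (by positivity : (0 : ℝ) ≤ 2 * π * (1 + P.γ) ^ (2 * j))
      (hLipC (has j) 0 (hgrad j).1)
    have eL : ∀ x : UnitAddTorus (Fin 2), ((b j x : ℝ) : ℂ) - ((b0 j x : ℝ) : ℂ) =
        ((a j (shearMap 0 1 (amp ⟨P.U j, P.U_periodic j, P.contDiff_U (P.δ_pos hδ₀ hd j)⟩ P.γ) x) : ℝ) : ℂ) -
          ((a0 j (x - Pi.single 0 ((((periodic_exactProfile P j).lift (x 1) : ℝ) : UnitAddCircle))) : ℝ) : ℂ) := by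
      intro x; rw [hb j, hb0 j]; rfl
    simp_rw [eL]
    exact h
  have stepV : ∀ j, Real.sqrt (∫ x : UnitAddTorus (Fin 2), ‖((a (j + 1) x : ℝ) : ℂ) - ((a0 (j + 1) x : ℝ) : ℂ)‖ ^ 2) ≤
      Real.sqrt ((2 * π * (1 + P.γ) ^ (2 * j + 1) * (P.γ * (Real.exp (-(M ^ 2 / 2)) / (2 * P.N j)))) ^ 2 +
        (2 * 1) ^ 2 * (4 * M * P.δ j / π)) +
        Real.sqrt (∫ x : UnitAddTorus (Fin 2), ‖((b j x : ℝ) : ℂ) - ((b0 j x : ℝ) : ℂ)‖ ^ 2) := by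
    intro j
    have h := sqrt_integral_norm_sq_rounded_sub_exact_le P hδ₀ hd hN₀ hρ hγ hM (hMδ j) (p := (1 : Fin 2)) (q := 0)
      (by decide) (hC (hbs j).continuous) (hC (hcont0 j).2) (hB (hsup j).2)
      (by positivity : (0 : ℝ) ≤ 2 * π * (1 + P.γ) ^ (2 * j + 1)) (hLipC (hbs j) 1 (hgrad j).2)
    have eL : ∀ x : UnitAddTorus (Fin 2), ((a (j + 1) x : ℝ) : ℂ) - ((a0 (j + 1) x : ℝ) : ℂ) =
        ((b j (shearMap 1 0 (amp ⟨P.U j, P.U_periodic j, P.contDiff_U (P.δ_pos hδ₀ hd j)⟩ P.γ) x) : ℝ) : ℂ) -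
          ((b0 j (x - Pi.single 1 ((((periodic_exactProfile P j).lift (x 0) : ℝ) : UnitAddCircle))) : ℝ) : ℂ) := by
      intro x; rw [hab j, hab0 j]; rfl
    simp_rw [eL]
    exact h
  -- induction over the phases
  have hA : ∀ n, Real.sqrt (∫ x : UnitAddTorus (Fin 2), ‖((a n x : ℝ) : ℂ) - ((a0 n x : ℝ) : ℂ)‖ ^ 2) ≤
      ∑ j ∈ Finset.range n,
        (Real.sqrt ((2 * π * (1 + P.γ) ^ (2 * j) * (P.γ * (Real.exp (-(M ^ 2 / 2)) / (2 * P.N j)))) ^ 2 +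
        (2 * 1) ^ 2 * (4 * M * P.δ j / π)) +
          Real.sqrt ((2 * π * (1 + P.γ) ^ (2 * j + 1) * (P.γ * (Real.exp (-(M ^ 2 / 2)) / (2 * P.N j)))) ^ 2 +
        (2 * 1) ^ 2 * (4 * M * P.δ j / π))) := by
    intro n
    induction n with
    | zero => simp [h0, h00]
    | succ n ih =>
      rw [Finset.sum_range_succ]
      linarith [stepV n, stepH n]
  exact ⟨hA n, by linarith [stepH n, hA n]⟩

end Cascade

end Summit.AnomalousDissipation.AnomalousDissipation.Theorems.SawtoothPulseCascade.K1Start
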